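import Summits.QuantumFields.BalabanUV.T4Continuum.Spine.NE1p.DressedTransportAssembledRatio
import Summits.QuantumFields.BalabanUV.T4Continuum.Spine.NE1p.DressedTransportUniform

/-!
# T⁴ programme, spine estimate NE1′ (node O3b/H2) — THE K-FREE PER-CUTOFF FACE: RATIO-END ∘ WINDOW SCHEDULE ∘ ROW S3
# (swarm row S3d of `t4/formal/NE1p/LEAVES.md` v2.2; typer ruling R-T16's condition «re-base S3b on S2c's ratio-END»)

Cell `pub-balaban`, sub-cell `t4`, BINDER-OWNERS row NE1′, formalisation crew `b2b-balaban-t4-ne1p-formalise-*`, seat `…-leaf-09`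
(holder of rows S3 ∕ S3b; INTENT NE1p-S3d in HOME/CLAIMS.log).  ADDITIVE — imports `Spine/NE1p/DressedTransportAssembledRatio`
(row S2c, leaf-01: the ratio-END `transportLeaf_assembled_ratio`, p213019) and `Spine/NE1p/DressedTransportUniform` (row S3b: the
ratio lemmas `hdom_of_ratioBound` ∕ `hα_of_ratioBound`, the witness `RatioGeometric.schedule`; through it rows S1 ∕ S3) ONLY.

WHAT THIS FILE DOES.  The ratio-END (S2c) displays NO radius floor and NO `hcm` — the (I4′) price sits in ONE displayed link
`hlink` per live generation — but still displays the window geometry (`hD`, `hϱ`, `hrs_birth`, `hrs_step`, `hrs_dec`, `hmargin`,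
`hN1`, `hN2`, `hN1x`, `hN2cx`, `hdiam`, `hθ`, `hw`), the step-factor profile's sign `hα` and (w4) `hdom`.  Under leaf-04's
`W : WindowSchedule r w` (row S1: `𝒦 b k′ k := bondBall d (ρw k)`, `D b k := bondBall d (σ k)`, `θ b k := 2σ k`, `ϱ b k′ k := ϱc k`,
`ϱ₁ b k := ϱ₁ k`, `rs f k″ k := sliceR W k″ k`, reference fluctuation `z₁ b k ∈ D b k`) and a DISPLAYED K-free diameter∕radius
ratio bound `hratio : ∀ k, 2σ k ≤ κ·ϱc k` (row S3b's `hdom_of_ratioBound`: (w4) with the CONSTANT profile `α := fun _ => alphaCell κ`),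
ALL FIFTEEN are discharged:

* §1 **`transportLeaf_ratio_of_schedule`** — conclusion VERBATIM the field type of `BookingLeaves.htr` at `C = 4c_δ∕r`,
  `ρ i = ψ·alphaCell κ`; displayed = (w1) `hsl`, H2 `hFn`∕`h𝒢`∕`hQ`∕`hSg`∕`hs1`∕`hAsz_birth`∕`hAsz_step`, (w2-act) `hB`∕`hE`
  (printed TYPE [Balaban1989LargeFieldII] (1.65) p. 375, (1.71)–(1.75) pp. 379–380 — asserted for Bałaban's densities NOWHERE),
  `hDμ`∕`hz₁`, (I4′) `hlink` (at the schedule's slice radii) ∕ `hδfw`∕`hpairx`∕`hdefw`∕`hrate`, attainment `hlin`, invariance,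
  measurability, scalars `hr`∕`hcδ`∕`hψ`∕`hm`, and `hratio`.
* §2 **`bookingLeaves_ratio_of_schedule`** : at the cell's transverse rate `ψ := L⁻²` (F-6's READING, caveat k3 — a parameter
  choice), `BookingLeaves (uniformConstantsCell L (4c_δ∕r) c̄ κ N₀ A₀ m s̄⁰ ρ′ …) B T` — the per-cutoff input of END-B — with `htr`
  discharged by §1 and (w7) `hρ`∕`hc`∕`hrate` by row S3; displayed in addition: (w5) `hreg` with `0 ≤ creg k ≤ c̄`, (w2-act) `hs₀`,
  (w3-book) `hS`∕`hcount` at rate `L⁴` (row S4's instance supplies them), (w1)+(w5b) `hbirth` (row S5's suppliers), and row S3's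
  located scalars `1 ≤ L`, `locCell L (4c_δ∕r) c̄ κ ≤ ρ′ < 1`, (w6) `hsmall`.  CAVEAT LF-1's FLOOR HALF IS ABSENT HERE (no `r_*`:
  chart radii may shrink as the schedule likes); its WINDOW half (`WindowSchedule.window_budget`: `ρw K + K·w ≤ ρw 0`, one chart
  window `w` per met step — leaf-08 F-ne1pleaf08-1 (4), repair R-b ∕ row S1c) is untouched and stays displayed through `hsl`'s
  window `bondBall d (ρw k′)`.
* §3 the κ = 2 instance on row S3b's floor-free witness `RatioGeometric.schedule r w ρ₀` (`transportLeaf_ratio_geometric`).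

HONEST FRAMING.  Kernel composition over hypothesis shapes ([folklore]; 0 sorry; 0 citations used as facts; no `def … : Prop`).
Headline: «BookingLeaves ∕ NE1′-per-cutoff ⇐ the DISPLAYED wall binders + located largeness + a ratio-bounded window schedule —
no floor, no separate (w4)», NEVER «NE1′ proved»; 0 leaves instantiated on Bałaban's densities; the wall (w1), (w2-act) THE NUMBER,
(w3)⁺ (incl. the window budget), (w5), (w6), (w7)'s located largeness, F-6's rate∕`hlink` stands; spine PROVED 0∕9.  Rung (B)+1 on
ONE finite four-torus — NOT infinite volume, NOT a mass gap, NOT OS on ℝ⁴, NOT Clay.  HONEST DEPENDENCY: continuum YM on T⁴ ⇐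
BetaPertH ∧ nine spine estimates (0/9 proved); BetaPertH ⇐ (D1) ∧ (D4) ∧ CAP+tail; G-an2-4 gates asym, D1 and NE2/3/4.
-/

noncomputable section

namespace Summit.QuantumFields.BalabanUV.T4Continuum.NE1p.DressedTransportRatioScheduled

open MeasureTheory Set Metric Finset
open scoped BigOperators
open Literature.MathematicalPhysics.QuantumFieldTheory.Balaban1983to89
open Literature.MathematicalPhysics.QuantumFieldTheory.Balaban1983to89.T4TermFormat
open Literature.MathematicalPhysics.QuantumFieldTheory.Balaban1983to89.T4GatedBooking
open Literature.MathematicalPhysics.QuantumFieldTheory.Balaban1983to89.T4TrajectoryComparison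
open Literature.MathematicalPhysics.QuantumFieldTheory.Balaban1983to89.T4TrajectoryModulus
open T4BirthChartTransport (GaugeInvariant BirthSlice RelGauge)
open T4BlockTransport (Fld NDir latMove latN)
open T4TrajectoryDensity
open Summit.QuantumFields.BalabanUV.T4Continuum.T4TrajectoryDensityDressed
open Summit.QuantumFields.BalabanUV.T4Continuum.NE1p.DressedRoot
open Summit.QuantumFields.BalabanUV.T4Continuum.NE1p.DressedWindowSchedule
open Summit.QuantumFields.BalabanUV.T4Continuum.NE1p.DressedTransportAssembledRatio
open Summit.QuantumFields.BalabanUV.T4Continuum.NE1p.DressedUniformConstants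
open Summit.QuantumFields.BalabanUV.T4Continuum.NE1p.DressedTransportUniform

/-! ## §1 The ratio-END under a ratio-bounded window schedule -/

section FunctionLevel

variable {r w : ℝ} (W : WindowSchedule r w)
variable {B : T4TermFormat.Booking} {T : Trajectory B}
variable {R : Type*} [NormedRing R] [NormedAlgebra ℂ R] [MeasurableSpace R] {d : ℕ}

/-- A ratio bound `2σ k ≤ κ·ϱc k` forces `κ ≥ 0` (diameters and radii are positive). [folklore] -/
theorem ratio_κ_nonneg {κ : ℝ} (hratio : ∀ k, 2 * W.σ k ≤ κ * W.ϱc k) : 0 ≤ κ :=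
  le_of_not_gt fun h =>
    (not_le.mpr ((mul_neg_of_neg_of_pos h (W.hϱc 0)).trans (by linarith [W.hσ 0]))) (hratio 0)

/-- **RATIO-END UNDER A RATIO-BOUNDED WINDOW SCHEDULE — NO FLOOR, NO WINDOW GEOMETRY, NO (w4) BINDER** [bookkeeping]: leaf-01's
`DressedTransportAssembledRatio.transportLeaf_assembled_ratio` with windows, fluctuation domains, diameters, chart ∕ margin ∕ slice
radii READ OFF `W : WindowSchedule r w` (row S1's discharges `hD_of_schedule` … `hN2cx_of_schedule` BY NAME) and the step-factor
profile FIXED to the K-free constant `α := fun _ => alphaCell κ` for a displayed ratio bound `hratio : ∀ k, 2σ k ≤ κ·ϱc k` (row S3b's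
`hdom_of_ratioBound` ∕ `hα_of_ratioBound`).  Displayed (wall ∕ dictionary only): (w1) `hsl`; H2 `hFn`∕`h𝒢` and the fresh-sum
dictionary `hQ`∕`hSg`∕`hs1`∕`hAsz_birth`∕`hAsz_step`; (w2-act) `hB`∕`hE`; `hDμ`∕`hz₁`; (I4′) the booked link `hlink` (transverse fresh
defect RELATIVE TO THE CURRENT CHART RADIUS `sliceR W k″ k`, source factor against budget factor), `hδfw`, `hpairx`, `hdefw`, `hrate`;
scalars `hr`∕`hcδ`∕`hψ`∕`hm`; attainment `hlin`; invariance; measurability.  Conclusion: VERBATIM the field type of `BookingLeaves.htr`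
with `C = 4c_δ∕r`, `ρ i = ψ·alphaCell κ`. [folklore] -/
theorem transportLeaf_ratio_of_schedule {κ : ℝ} {Fn : B.Birth → ℕ → ℕ → Fld d R → ℂ}
    {rel : B.Birth → ℕ → ℕ → Fld d R → Fld d R → Prop}
    {ref : B.Birth → ℕ → Fld d R → Fld d R} {base : B.Birth → ℕ → Fld d R → ℝ}
    {𝒜 𝒬 : B.Birth → ℕ → Fld d R → Fld d R → ℂ} {q : B.Birth → ℕ → Fld d R → ℂ}
    {μ : B.Birth → ℕ → Measure (Fld d R)} {z₀ z₁ : B.Birth → ℕ → Fld d R}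
    {defect : B.Birth → ℕ → ℕ → ℝ} {cδ ψ m : ℝ} {s s1 : B.Birth → ℕ → ℝ}
    {Asz : B.Birth → ℕ → ℕ → ℝ} {S : ℕ → B.Birth → Finset B.Birth}
    {Sg : ℕ → B.Birth → Finset (B.Birth × ℕ)} {c : B.Birth → ℕ → ℂ} {δf : B.Birth → ℕ → B.Birth × ℕ → ℝ}
    (hratio : ∀ k, 2 * W.σ k ≤ κ * W.ϱc k)
    (hr : 0 < r) (hcδ : 0 ≤ cδ) (hψ : 0 ≤ ψ) (hm : 0 ≤ m)
    (hsl : ∀ (b : B.Birth) (k' : ℕ), B.birthScale b ≤ k' → k' ≤ B.K →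
      RanBelow (budgetGate T s m S (4 * cδ / r) (fun i => ψ * (fun _ : ℕ => alphaCell κ) i)) k' →
      BirthSlice (Fn b k' k') latMove latN (bondBall d (W.ρw k') : Set (Fld d R)) w r (T.gen b k'))
    (hFn : ∀ (b : B.Birth) (k' k : ℕ), B.birthScale b ≤ k' → k' ≤ k → k + 1 ≤ B.K →
      RanBelow (budgetGate T s m S (4 * cδ / r) (fun i => ψ * (fun _ : ℕ => alphaCell κ) i)) (k + 1) →
      ∀ U, Fn b k' (k + 1) U =
        wOp (expWeight (base b k) (𝒜 b k + 𝒬 b k)) (μ b k) (z₀ b k) U (fun z => Fn b k' k (U + z)))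
    (h𝒢 : ∀ (b : B.Birth) (k' k : ℕ), B.birthScale b ≤ k' → k' ≤ k → k + 1 ≤ B.K →
      RanBelow (budgetGate T s m S (4 * cδ / r) (fun i => ψ * (fun _ : ℕ => alphaCell κ) i)) (k + 1) →
      ∀ U, (fun z => Fn b k' k (U + z)) ∈ BddClass ℂ (μ b k))
    (hB : ∀ (b : B.Birth) (k' k : ℕ), B.birthScale b ≤ k' → k' ≤ k → k + 1 ≤ B.K →
      RanBelow (budgetGate T s m S (4 * cδ / r) (fun i => ψ * (fun _ : ℕ => alphaCell κ) i)) (k + 1) →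
      RealBaseAt (ref b k) (base b k) (𝒜 b k) (μ b k) (bondBall d (W.ρw (k + 1)) : Set (Fld d R)))
    (hE : ∀ (b : B.Birth) (k' k : ℕ), B.birthScale b ≤ k' → k' ≤ k → k + 1 ≤ B.K →
      RanBelow (budgetGate T s m S (4 * cδ / r) (fun i => ψ * (fun _ : ℕ => alphaCell κ) i)) (k + 1) →
      ExponentSliceAt (ref b k) (𝒜 b k) (μ b k) latMove latN (bondBall d (W.ρw (k + 1)) : Set (Fld d R)) w (W.ϱc k)
        (s b k))
    (hQ : ∀ b k, (fun U z => 𝒬 b k U z - q b k U) =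
      fun U z => c b k * ∑ p ∈ Sg k b, (Fn p.1 p.2 k (U + z) - Fn p.1 p.2 k (U + z₁ b k)))
    (hSg : ∀ k b, ∀ p ∈ Sg k b, p.1 ∈ S k b ∧ B.birthScale p.1 ≤ p.2 ∧ p.2 ≤ k)
    (hs1 : ∀ b k, s1 b k = ‖c b k‖ * ∑ p ∈ Sg k b, 4 * Asz p.1 p.2 k / W.sliceR p.2 k * δf b k p)
    (hAsz_birth : ∀ f k'', Asz f k'' k'' = T.gen f k'')
    (hAsz_step : ∀ f k'' k, B.birthScale f ≤ k'' → k'' ≤ k →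
      Asz f k'' (k + 1) = Real.exp (3 * (s f k + s1 f k)) * Asz f k'' k)
    (hlink : ∀ b k, ∀ p ∈ Sg k b,
      0 ≤ δf b k p ∧ ‖c b k‖ * (δf b k p / W.sliceR p.2 k) ≤ m * (cδ / r) * ψ ^ (k - p.2))
    (hδfw : ∀ b k, ∀ p ∈ Sg k b, δf b k p ≤ w)
    (hDμ : ∀ b k, ∀ᵐ z ∂μ b k, z ∈ (bondBall d (W.σ k) : Set (Fld d R)))
    (hz₁ : ∀ b k, z₁ b k ∈ (bondBall d (W.σ k) : Set (Fld d R)))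
    (hpairx : ∀ (b : B.Birth) (k' k : ℕ), B.birthScale b ≤ k' → k' ≤ k →
      ∀ p ∈ Sg k b, ∀ U₀ ∈ (bondBall d (W.ρw (k + 1)) : Set (Fld d R)), ∀ pd : NDir d R, 0 < latN pd → latN pd ≤ w →
        ∀ᵐ z ∂μ b k, ∀ t ∈ tube (W.ϱ₁ k / latN pd),
          RelGauge (rel p.1 p.2 k) latMove latN (latMove U₀ pd t + z₁ b k) (latMove U₀ pd t + z) (δf b k p))
    (hinv : ∀ b k' k, GaugeInvariant (rel b k' k) (Fn b k' k))
    (hmeas : ∀ (b f : B.Birth) (k'' k : ℕ) (U : Fld d R), AEStronglyMeasurable (fun z => Fn f k'' k (U + z)) (μ b k))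
    (hdefw : ∀ b k' k, defect b k' k ≤ w)
    (hrate : ∀ (b : B.Birth) (k' k : ℕ), B.birthScale b ≤ k' → k' ≤ k → k ≤ B.K →
      defect b k' k ≤ cδ * ψ ^ (k - k'))
    (hlin : ∀ (b : B.Birth) (k' k : ℕ), B.birthScale b ≤ k' → k' ≤ k → k ≤ B.K →
      RanBelow (budgetGate T s m S (4 * cδ / r) (fun i => ψ * (fun _ : ℕ => alphaCell κ) i)) k → ∀ ε > 0,
      ∃ U₀ ∈ (bondBall d (W.ρw k) : Set (Fld d R)), ∃ U₁ : Fld d R,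
        RelGauge (rel b k' k) latMove latN U₀ U₁ (defect b k' k) ∧
        T.lin b k' k ≤ ‖Fn b k' k U₁ - Fn b k' k U₀‖ + ε) :
    T.TransportsFromVar (4 * cδ / r) (fun i => ψ * (fun _ : ℕ => alphaCell κ) i)
      (budgetGate T s m S (4 * cδ / r) (fun i => ψ * (fun _ : ℕ => alphaCell κ) i)) :=
  transportLeaf_assembled_ratio (𝒦 := fun _ _ k => (bondBall d (W.ρw k) : Set (Fld d R)))
    (D := fun _ k => (bondBall d (W.σ k) : Set (Fld d R))) (θ := fun _ k => 2 * W.σ k) (ϱ := fun _ _ k => W.ϱc k)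
    (ϱ₁ := fun _ k => W.ϱ₁ k) (rs := fun _ k'' k => W.sliceR k'' k)
    (hα_of_ratioBound W hratio) hr W.w_pos hcδ hψ hm hsl hFn h𝒢 (hD_of_schedule W) (hϱ_of_schedule W) hB hE hQ hSg hs1
    hAsz_birth (hrs_birth_of_schedule W) hAsz_step (hrs_step_of_schedule W) (hrs_dec_of_schedule W) (hmargin_of_schedule W Sg)
    hlink hδfw hDμ (hN1_of_schedule W) (hN2_of_schedule W) (hN1x_of_schedule W Sg) (hN2cx_of_schedule W Sg hz₁) hpairx
    (hdiam_of_schedule W) (hθ_of_schedule W) (fun _ _ k _ _ hk => hdom_of_ratioBound W hratio k hk) hinv hmeas hdefw hrate hlin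

end FunctionLevel

/-! ## §2 The K-free per-cutoff face: `BookingLeaves` over the uniform constants -/

section Bundle

variable {r w : ℝ} (W : WindowSchedule r w)
variable {B : T4TermFormat.Booking} {T : Trajectory B}
variable {R : Type*} [NormedRing R] [NormedAlgebra ℂ R] [MeasurableSpace R] {d : ℕ}

/-- **THE CREW'S K-FREE PER-CUTOFF BUNDLE** [bookkeeping]: at the cell's transverse rate `ψ := L⁻²` (F-6's reading — a parameter
choice) and the K-∕μ-free constants `U := uniformConstantsCell L (4c_δ∕r) c̄ κ N₀ A₀ m s̄⁰ ρ′` of row S3, the leaf binders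
`BookingLeaves U B T` of END-B with T `htr` DISCHARGED by §1 (no floor, no window geometry, no (w4) — a ratio-bounded schedule
instead) and (w7) `hrate`∕`hρ`∕`hc` DISCHARGED by row S3.  DISPLAYED, per cutoff: §1's wall ∕ dictionary binders (incl. the
(I4′) link `hlink` and the ratio `hratio`); (w5) `hreg` with `0 ≤ creg k ≤ c̄`; (w2-act) `hs₀ : s b k ≤ s̄⁰`; (w3-book)
`hS`∕`hcount` at rate `L⁴` (row S4's instance); (w1)+(w5b) `hbirth` in the class `twoRate A₀ (rhoOne L⁻² (4c_δ∕r) c̄ κ) L⁻³ K`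
(row S5's suppliers); row S3's located scalars `1 ≤ L`, `locCell L (4c_δ∕r) c̄ κ ≤ ρ′ < 1` ((w7)), `m·(N₀A₀(1−ρ′)⁻¹) ≤ 1 − s̄⁰`
((w6)).  The schedule's window budget (`ρw K + K·w ≤ ρw 0`, LF-1's window half) stays inside `hsl`'s window `bondBall d (ρw k′)`.
Feed `∀ p K` of it to END-B (`dressedStability_of_cell`).  Nothing of Bałaban's densities asserted. [folklore] -/
def bookingLeaves_ratio_of_schedule {κ L cbar N₀ A₀ sbar ρ' : ℝ} {Fn : B.Birth → ℕ → ℕ → Fld d R → ℂ}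
    {rel : B.Birth → ℕ → ℕ → Fld d R → Fld d R → Prop}
    {ref : B.Birth → ℕ → Fld d R → Fld d R} {base : B.Birth → ℕ → Fld d R → ℝ}
    {𝒜 𝒬 : B.Birth → ℕ → Fld d R → Fld d R → ℂ} {q : B.Birth → ℕ → Fld d R → ℂ}
    {μ : B.Birth → ℕ → Measure (Fld d R)} {z₀ z₁ : B.Birth → ℕ → Fld d R}
    {defect : B.Birth → ℕ → ℕ → ℝ} {cδ m : ℝ} {s s1 : B.Birth → ℕ → ℝ}
    {Asz : B.Birth → ℕ → ℕ → ℝ} {S : ℕ → B.Birth → Finset B.Birth}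
    {Sg : ℕ → B.Birth → Finset (B.Birth × ℕ)} {c : B.Birth → ℕ → ℂ} {δf : B.Birth → ℕ → B.Birth × ℕ → ℝ}
    {creg : ℕ → ℝ}
    -- the schedule's K-free diameter∕radius ratio
    (hratio : ∀ k, 2 * W.σ k ≤ κ * W.ϱc k)
    -- row S3's located scalars ((w7) largeness, (w6) window) and signs
    (hL : 1 ≤ L) (hcbar : 0 ≤ cbar) (hN₀ : 0 ≤ N₀) (hA₀ : 0 ≤ A₀) (hm : 0 ≤ m)
    (hloc : locCell L (4 * cδ / r) cbar κ ≤ ρ') (hρ'1 : ρ' < 1)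
    (hsmall : m * (N₀ * A₀ * (1 - ρ')⁻¹) ≤ 1 - sbar)
    -- scalars of the ratio-END
    (hr : 0 < r) (hcδ : 0 ≤ cδ)
    -- the ratio-END's wall ∕ dictionary binders at ψ := L⁻²
    (hsl : ∀ (b : B.Birth) (k' : ℕ), B.birthScale b ≤ k' → k' ≤ B.K →
      RanBelow (budgetGate T s m S (4 * cδ / r) (fun i => (L ^ 2)⁻¹ * (fun _ : ℕ => alphaCell κ) i)) k' →
      BirthSlice (Fn b k' k') latMove latN (bondBall d (W.ρw k') : Set (Fld d R)) w r (T.gen b k'))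
    (hFn : ∀ (b : B.Birth) (k' k : ℕ), B.birthScale b ≤ k' → k' ≤ k → k + 1 ≤ B.K →
      RanBelow (budgetGate T s m S (4 * cδ / r) (fun i => (L ^ 2)⁻¹ * (fun _ : ℕ => alphaCell κ) i)) (k + 1) →
      ∀ U, Fn b k' (k + 1) U =
        wOp (expWeight (base b k) (𝒜 b k + 𝒬 b k)) (μ b k) (z₀ b k) U (fun z => Fn b k' k (U + z)))
    (h𝒢 : ∀ (b : B.Birth) (k' k : ℕ), B.birthScale b ≤ k' → k' ≤ k → k + 1 ≤ B.K →
      RanBelow (budgetGate T s m S (4 * cδ / r) (fun i => (L ^ 2)⁻¹ * (fun _ : ℕ => alphaCell κ) i)) (k + 1) →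
      ∀ U, (fun z => Fn b k' k (U + z)) ∈ BddClass ℂ (μ b k))
    (hB : ∀ (b : B.Birth) (k' k : ℕ), B.birthScale b ≤ k' → k' ≤ k → k + 1 ≤ B.K →
      RanBelow (budgetGate T s m S (4 * cδ / r) (fun i => (L ^ 2)⁻¹ * (fun _ : ℕ => alphaCell κ) i)) (k + 1) →
      RealBaseAt (ref b k) (base b k) (𝒜 b k) (μ b k) (bondBall d (W.ρw (k + 1)) : Set (Fld d R)))
    (hE : ∀ (b : B.Birth) (k' k : ℕ), B.birthScale b ≤ k' → k' ≤ k → k + 1 ≤ B.K →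
      RanBelow (budgetGate T s m S (4 * cδ / r) (fun i => (L ^ 2)⁻¹ * (fun _ : ℕ => alphaCell κ) i)) (k + 1) →
      ExponentSliceAt (ref b k) (𝒜 b k) (μ b k) latMove latN (bondBall d (W.ρw (k + 1)) : Set (Fld d R)) w (W.ϱc k)
        (s b k))
    (hQ : ∀ b k, (fun U z => 𝒬 b k U z - q b k U) =
      fun U z => c b k * ∑ p ∈ Sg k b, (Fn p.1 p.2 k (U + z) - Fn p.1 p.2 k (U + z₁ b k)))
    (hSg : ∀ k b, ∀ p ∈ Sg k b, p.1 ∈ S k b ∧ B.birthScale p.1 ≤ p.2 ∧ p.2 ≤ k)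
    (hs1 : ∀ b k, s1 b k = ‖c b k‖ * ∑ p ∈ Sg k b, 4 * Asz p.1 p.2 k / W.sliceR p.2 k * δf b k p)
    (hAsz_birth : ∀ f k'', Asz f k'' k'' = T.gen f k'')
    (hAsz_step : ∀ f k'' k, B.birthScale f ≤ k'' → k'' ≤ k →
      Asz f k'' (k + 1) = Real.exp (3 * (s f k + s1 f k)) * Asz f k'' k)
    (hlink : ∀ b k, ∀ p ∈ Sg k b,
      0 ≤ δf b k p ∧ ‖c b k‖ * (δf b k p / W.sliceR p.2 k) ≤ m * (cδ / r) * ((L ^ 2)⁻¹) ^ (k - p.2))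
    (hδfw : ∀ b k, ∀ p ∈ Sg k b, δf b k p ≤ w)
    (hDμ : ∀ b k, ∀ᵐ z ∂μ b k, z ∈ (bondBall d (W.σ k) : Set (Fld d R)))
    (hz₁ : ∀ b k, z₁ b k ∈ (bondBall d (W.σ k) : Set (Fld d R)))
    (hpairx : ∀ (b : B.Birth) (k' k : ℕ), B.birthScale b ≤ k' → k' ≤ k →
      ∀ p ∈ Sg k b, ∀ U₀ ∈ (bondBall d (W.ρw (k + 1)) : Set (Fld d R)), ∀ pd : NDir d R, 0 < latN pd → latN pd ≤ w →
        ∀ᵐ z ∂μ b k, ∀ t ∈ tube (W.ϱ₁ k / latN pd),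
          RelGauge (rel p.1 p.2 k) latMove latN (latMove U₀ pd t + z₁ b k) (latMove U₀ pd t + z) (δf b k p))
    (hinv : ∀ b k' k, GaugeInvariant (rel b k' k) (Fn b k' k))
    (hmeas : ∀ (b f : B.Birth) (k'' k : ℕ) (U : Fld d R), AEStronglyMeasurable (fun z => Fn f k'' k (U + z)) (μ b k))
    (hdefw : ∀ b k' k, defect b k' k ≤ w)
    (hrate : ∀ (b : B.Birth) (k' k : ℕ), B.birthScale b ≤ k' → k' ≤ k → k ≤ B.K →
      defect b k' k ≤ cδ * ((L ^ 2)⁻¹) ^ (k - k'))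
    (hlin : ∀ (b : B.Birth) (k' k : ℕ), B.birthScale b ≤ k' → k' ≤ k → k ≤ B.K →
      RanBelow (budgetGate T s m S (4 * cδ / r) (fun i => (L ^ 2)⁻¹ * (fun _ : ℕ => alphaCell κ) i)) k →
      ∀ ε > 0, ∃ U₀ ∈ (bondBall d (W.ρw k) : Set (Fld d R)), ∃ U₁ : Fld d R,
        RelGauge (rel b k' k) latMove latN U₀ U₁ (defect b k' k) ∧
        T.lin b k' k ≤ ‖Fn b k' k U₁ - Fn b k' k U₀‖ + ε)
    -- the booking-level wall binders: (w5) regeneration, (w2-act) margin, (w3-book) counts, (w1)+(w5b) births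
    (hc0 : ∀ k, 0 ≤ creg k) (hcb : ∀ k, k < B.K → creg k ≤ cbar)
    (hreg : T.RegeneratesFromVar creg
      (budgetGate T s m S (4 * cδ / r) (fun _ : ℕ => (L ^ 2)⁻¹ * alphaCell κ)))
    (hs₀ : ∀ b k, s b k ≤ sbar)
    (hS : ∀ k b, ∀ f ∈ S k b, B.birthScale f ≤ k)
    (hcount : ∀ k b, ∀ j ≤ k, (((S k b).filter fun f => B.birthScale f = j).card : ℝ) ≤ N₀ * (L ^ 4) ^ (k - j))
    (hbirth : T.BirthsFromOld (4 * cδ / r) (fun _ : ℕ => (L ^ 2)⁻¹ * alphaCell κ)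
      (twoRate A₀ (rhoOne (L ^ 2)⁻¹ (4 * cδ / r) cbar κ) (L⁻¹ ^ 3) B.K)
      (budgetGate T s m S (4 * cδ / r) (fun _ : ℕ => (L ^ 2)⁻¹ * alphaCell κ))) :
    BookingLeaves (uniformConstantsCell L (4 * cδ / r) cbar κ N₀ A₀ m sbar ρ' hL
      (div_nonneg (mul_nonneg (by norm_num) hcδ) hr.le) hcbar (ratio_κ_nonneg W hratio) hN₀ hA₀ hm hloc hρ'1 hsmall) B T :=
  bookingLeavesCell hL (div_nonneg (mul_nonneg (by norm_num) hcδ) hr.le) hcbar (ratio_κ_nonneg W hratio) hN₀ hA₀ hm hloc hρ'1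
    hsmall creg s S hc0 hcb hS hcount hs₀ hbirth
    (transportLeaf_ratio_of_schedule W hratio hr hcδ (inv_nonneg.mpr (sq_nonneg L)) hm hsl hFn h𝒢 hB hE hQ hSg hs1 hAsz_birth
      hAsz_step hlink hδfw hDμ hz₁ hpairx hinv hmeas hdefw hrate hlin)
    hreg

end Bundle

/-! ## §3 The κ = 2 instance on the floor-free witness -/

section Witness

variable {B : T4TermFormat.Booking}

/-- [decided toy] Row S3b's floor-free witness `RatioGeometric.schedule r w ρ₀` inhabits §1's ratio binder with `κ = 2`:
`2σ k ≤ 2·ϱc k` (`RatioGeometric.ratio_le`) — so §1 ∕ §2 apply along it with the K-free profile `α := fun _ => alphaCell 2`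
and NO floor (chart radii `r·2^{−(k+2)}` shrinking geometrically); its windows are those of leaf-04's witnesses, inhabited up to
step `K` under `(2w + r)·K ≤ ρ₀` (`Floored.zero_mem_window` via `RatioGeometric.ρw_eq_floored`). [folklore] -/
theorem ratio_geometric (r w ρ₀ : ℝ) (hr : 0 < r) (hw : 0 < w) :
    ∀ k, 2 * (RatioGeometric.schedule r w ρ₀ hr hw).σ k ≤ 2 * (RatioGeometric.schedule r w ρ₀ hr hw).ϱc k :=
  RatioGeometric.ratio_le r w ρ₀ hr hw

/-- [decided toy] Along the floor-free witness, (w4) in the ratio-END's indexing holds with `α := fun _ => alphaCell 2`. [folklore] -/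
theorem hdom_ratio_geometric (r w ρ₀ : ℝ) (hr : 0 < r) (hw : 0 < w) :
    ∀ (b : B.Birth) (k' k : ℕ), B.birthScale b ≤ k' → k' ≤ k → k + 1 ≤ B.K →
      Real.exp 3 * (1 + 4 * (2 * (RatioGeometric.schedule r w ρ₀ hr hw).σ k) /
        (RatioGeometric.schedule r w ρ₀ hr hw).ϱc k) ≤ (fun _ : ℕ => alphaCell 2) k :=
  fun _ _ k _ _ hk => hdom_of_ratioBound (RatioGeometric.schedule r w ρ₀ hr hw) (B := B) (ratio_geometric r w ρ₀ hr hw) k hk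

end Witness

end Summit.QuantumFields.BalabanUV.T4Continuum.NE1p.DressedTransportRatioScheduled

end
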